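import Mathlib
import Summits.ValiantsHypothesis.ValiantsHypothesis.Theorems.ContractivityPricePriceOfContractivityStubBalancedBudgetInjective
import HarnessLib

/-!
# Crux `PriceOfContractivity` (stmt-ValiantsHypothesis-10583), line `birth` — stub `stub_normHalving`,
# partial case: MULTIAFFINE inputs in the budget regime (`κ` injective, `M ≥ 120 R⁵`)

The registered stub `stub_normHalving` (one halving of the operator norm, `‖K‖ ≤ 2M ⟹ ‖K'‖ ≤ M`,
`M ≥ 1`, for a margin-2-stable Sylvester pencil, at a size factor quasi-polynomial in a bound `n` on
the number of variables and the degree) is proved here in the special case of an INJECTIVE colouring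
(multiaffine pencil determinant) and a large remaining budget `120 R⁵ ≤ M`: then the landed multiaffine
balanced budget (`BalancedBudgetInjective.stub_balancedBudget_injective`: a positive diagonal similarity
`K₁ = D K D⁻¹` with `‖K₁‖_op ≤ 120 R⁵` and the same pencil determinant — Theorem 4, the cycle-mean bound,
plus max-plus balancing) already gives `‖K₁‖ ≤ M` at the SAME size, so `R' = R`, `κ' = κ`, `c = 0`.
This is the "budget regime" of the halving stub; the case `M = 1` (to which the general stub reduces by
rescaling, `stub_normHalving_rescale.lean`) is open even for injective `κ` once `R ≥ 4`
(`work/stubs/nh_notes.md` §2).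
-/

set_option linter.dupNamespace false

namespace Summit.ValiantsHypothesis.ValiantsHypothesis.Theorems.PriceOfContractivity.NormHalving

open MvPolynomial Matrix

/-- **`stub_normHalving`, multiaffine budget regime.** For an injective colouring `κ` and
`120 R⁵ ≤ M`, one halving is free at the same size: the balanced matrix `K₁ = D K D⁻¹` of the landed
multiaffine balanced budget has `‖K₁‖ ≤ 120 R⁵ ≤ M` and the same pencil determinant. -/
theorem stub_normHalving_injectiveBudget :
    ∃ c : ℕ, ∀ (n R : ℕ) (M : ℝ) {σ : Type} [Fintype σ] (K : Matrix (Fin R) (Fin R) ℂ) (κ : Fin R → σ),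
      Function.Injective κ →
      120 * (R : ℝ) ^ 5 ≤ M →
      Fintype.card σ ≤ n →
      (1 + Matrix.diagonal (fun i => MvPolynomial.X (κ i)) * K.map (fun a : ℂ => (MvPolynomial.C a : MvPolynomial σ ℂ))).det.totalDegree ≤ n →
      1 ≤ M →
      ‖Matrix.toEuclideanCLM (𝕜 := ℂ) K‖ ≤ 2 * M →
      (∀ z : σ → ℂ, (∀ j, ‖z j‖ ≤ 2) → MvPolynomial.eval z (1 + Matrix.diagonal (fun i => MvPolynomial.X (κ i)) * K.map (fun a : ℂ => (MvPolynomial.C a : MvPolynomial σ ℂ))).det ≠ 0) →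
      ∃ R' ≤ 2 ^ ((Nat.log 2 n + c) ^ c) * R, ∃ (K' : Matrix (Fin R') (Fin R') ℂ) (κ' : Fin R' → σ),
        ‖Matrix.toEuclideanCLM (𝕜 := ℂ) K'‖ ≤ M ∧
        (1 + Matrix.diagonal (fun i => MvPolynomial.X (κ i)) * K.map (fun a : ℂ => (MvPolynomial.C a : MvPolynomial σ ℂ))).det =
          (1 + Matrix.diagonal (fun i => MvPolynomial.X (κ' i)) * K'.map (fun a : ℂ => (MvPolynomial.C a : MvPolynomial σ ℂ))).det := by
  refine ⟨0, ?_⟩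
  intro n R M σ _ K κ hκ hRM _hσ _hdeg _hM _hK hz
  obtain ⟨K₁, hK₁, hdet⟩ := BalancedBudgetInjective.stub_balancedBudget_injective R K κ hκ hz
  refine ⟨R, ?_, K₁, κ, hK₁.trans hRM, hdet⟩
  calc R = 1 * R := (one_mul R).symm
    _ ≤ 2 ^ ((Nat.log 2 n + 0) ^ 0) * R := Nat.mul_le_mul_right R (by norm_num)

end Summit.ValiantsHypothesis.ValiantsHypothesis.Theorems.PriceOfContractivity.NormHalving
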